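import Summits.QuantumAdvantage.QuantumAdvantage.Theorems.CharDialTokenDialA1

/-!
# CharDial tower — the TOKEN DIAL, part A2: cells of linear forms mod `p` and two-moduli equidistribution of one address (§4)

Cell `decomp-qadv`, lens 6, generation 19; split part 2 of 3 of the lens file `CharDialTokenDialA.lean` (sha f4f92cd1…); content verbatim.
Analytic input BY NAME: `Literature.Computability.MetaComplexity.TwoModuliExpSums`.  0 sorry.
-/

set_option autoImplicit false

namespace Summit.QuantumAdvantage.AdviceFreeQNC0.JLinPeel.TokenDial

open Finset SegMove

variable {n : ℕ}

/-! ### §4 the analytic input: the address of a cut is equidistributed mod 3 on cells of linear forms mod `p` -/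

section Cells

variable {p : ℕ} [hp : Fact p.Prime]

/-- the CELL of a junta pattern `β` on `O` and a form value `v`: inputs agreeing with `β` on `O` whose form is `v`. -/
def cell (O : Finset (Fin n)) (β : Fin n → Bool) (a : Fin n → ZMod p) (v : ZMod p) : Finset (Fin n → Bool) :=
  univ.filter fun w => (∀ j ∈ O, w j = β j) ∧ form a w = v

omit hp in
/-- membership in a cell. -/
theorem mem_cell (O : Finset (Fin n)) (β : Fin n → Bool) (a : Fin n → ZMod p) (v : ZMod p) (w : Fin n → Bool) :
    w ∈ cell O β a v ↔ (∀ j ∈ O, w j = β j) ∧ form a w = v := by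
  unfold cell; rw [mem_filter]; simp only [mem_univ, true_and]

/-- the linear forms presenting a cell to the Literature lemma: coordinate indicators on `O` (indices `< n`), then `a`. -/
def lamO (O : Finset (Fin n)) (a : Fin n → ZMod p) : Fin (n + 1) → Fin n → ZMod p := fun j i =>
  if h : j.val < n then (if i = ⟨j.val, h⟩ then (if (⟨j.val, h⟩ : Fin n) ∈ O then 1 else 0) else 0) else a i

/-- the cell label. -/
def vlO (O : Finset (Fin n)) (β : Fin n → Bool) (v : ZMod p) : Fin (n + 1) → ZMod p := fun j =>
  if h : j.val < n then (if (⟨j.val, h⟩ : Fin n) ∈ O ∧ β ⟨j.val, h⟩ = true then 1 else 0) else v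

/-- a coordinate indicator form reads one bit. -/
theorem sum_indicator (w : Fin n → Bool) (j : Fin n) (e : ZMod p) :
    (∑ i : Fin n, if w i = true then (if i = j then e else 0) else 0) = if w j = true then e else 0 := by
  rw [Finset.sum_eq_single j]
  · simp
  · intro i _ hi; simp [hi]
  · intro h; exact absurd (mem_univ j) h

/-- a low-index form of `lamO` reads the bit at that index (if it lies in `O`). -/
theorem sum_lamO_low (O : Finset (Fin n)) (a : Fin n → ZMod p) (w : Fin n → Bool) (j' : Fin (n + 1))
    (h : j'.val < n) :
    (∑ i : Fin n, if w i = true then lamO O a j' i else 0) =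
      if (⟨j'.val, h⟩ : Fin n) ∈ O ∧ w ⟨j'.val, h⟩ = true then 1 else 0 := by
  unfold lamO
  simp only [dif_pos h]
  rw [sum_indicator]
  by_cases hO : (⟨j'.val, h⟩ : Fin n) ∈ O <;> simp [hO]

/-- the last form of `lamO` is `a`. -/
theorem sum_lamO_last (O : Finset (Fin n)) (a : Fin n → ZMod p) (w : Fin n → Bool) (j' : Fin (n + 1))
    (h : ¬ j'.val < n) : (∑ i : Fin n, if w i = true then lamO O a j' i else 0) = form a w := by
  unfold lamO form
  simp only [dif_neg h]

/-- value of the cell-linear form `vlO` at a low index (`j < n`). -/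
theorem vlO_low (O : Finset (Fin n)) (β : Fin n → Bool) (v : ZMod p) (j' : Fin (n + 1)) (h : j'.val < n) :
    vlO O β v j' = if (⟨j'.val, h⟩ : Fin n) ∈ O ∧ β ⟨j'.val, h⟩ = true then 1 else 0 := by
  unfold vlO; simp only [dif_pos h]

/-- value of the cell-linear form `vlO` at the last index (`j = n`). -/
theorem vlO_last (O : Finset (Fin n)) (β : Fin n → Bool) (v : ZMod p) (j' : Fin (n + 1)) (h : ¬ j'.val < n) :
    vlO O β v j' = v := by
  unfold vlO; simp only [dif_neg h]

/-- the forms `lamO` with label `vlO` cut out exactly the cell. -/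
theorem forms_eq_iff (O : Finset (Fin n)) (β : Fin n → Bool) (a : Fin n → ZMod p) (v : ZMod p) (w : Fin n → Bool) :
    ((fun j => ∑ i, if w i then lamO O a j i else 0) = vlO O β v) ↔ ((∀ j ∈ O, w j = β j) ∧ form a w = v) := by
  haveI : Fact (1 < p) := ⟨hp.out.one_lt⟩
  have hlast : ¬ (Fin.last n).val < n := by simp
  constructor
  · intro H
    refine ⟨fun j hj => ?_, ?_⟩
    · have h := congrFun H ⟨j.val, Nat.lt_succ_of_lt j.isLt⟩
      have ej : (⟨j.val, j.isLt⟩ : Fin n) = j := rfl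
      rw [sum_lamO_low O a w ⟨j.val, Nat.lt_succ_of_lt j.isLt⟩ j.isLt,
        vlO_low O β v ⟨j.val, Nat.lt_succ_of_lt j.isLt⟩ j.isLt] at h
      simp only [ej, hj, true_and] at h
      revert h
      rcases Bool.eq_false_or_eq_true (w j) with h1 | h1 <;>
        rcases Bool.eq_false_or_eq_true (β j) with h2 | h2 <;> simp [h1, h2]
    · have h := congrFun H (Fin.last n)
      simp only [sum_lamO_last O a w _ hlast, vlO_last O β v _ hlast] at h
      exact h
  · rintro ⟨hO, hf⟩
    funext j'
    by_cases h : j'.val < n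
    · rw [sum_lamO_low O a w j' h, vlO_low O β v j' h]
      by_cases hjO : (⟨j'.val, h⟩ : Fin n) ∈ O
      · rw [hO _ hjO]
      · simp [hjO]
    · rw [sum_lamO_last O a w j' h, vlO_last O β v j' h]
      exact hf

/-- **LAW (two-moduli equidistribution on cells; the Literature input).** on every cell of a junta pattern and a form value,
the Hamming weight mod 3 is within `2(2cos(π/(3p)))ⁿ` of uniform (counting form, `3 ∤ p`):
[ChattopadhyayWigderson2009, Lemma 5] = `TwoModuli.abs_three_mul_card_cell_sub_card_le` with `n+1` forms. -/
theorem third_on_cells (hp3 : p ≠ 3) (O : Finset (Fin n)) (β : Fin n → Bool) (a : Fin n → ZMod p) (v : ZMod p)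
    (r : ZMod 3) :
    |3 * (((cell O β a v).filter fun w => ((wt w : ℕ) : ZMod 3) = r).card : ℝ) - ((cell O β a v).card : ℝ)|
      ≤ 2 * (2 * Real.cos (Real.pi / (3 * p))) ^ n := by
  classical
  haveI : NeZero p := ⟨hp.out.ne_zero⟩
  have hcop : p.Coprime 3 := (Nat.coprime_primes hp.out Nat.prime_three).mpr hp3
  have h := Literature.Computability.MetaComplexity.TwoModuli.abs_three_mul_card_cell_sub_card_le
    (ι := Fin n) hcop (lamO O a) (vlO O β v) r
  have e1 : (univ.filter fun u : Fin n → Bool =>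
        ((univ.filter fun i => u i = true).card : ZMod 3) = r ∧ (fun j => ∑ i, if u i then lamO O a j i else 0) = vlO O β v)
      = (cell O β a v).filter fun w => ((wt w : ℕ) : ZMod 3) = r := by
    unfold cell
    rw [filter_filter]
    refine filter_congr fun w _ => ?_
    rw [forms_eq_iff]
    unfold wt
    tauto
  have e2 : (univ.filter fun u : Fin n → Bool => (fun j => ∑ i, if u i then lamO O a j i else 0) = vlO O β v)
      = cell O β a v := by
    unfold cell
    exact filter_congr fun w _ => forms_eq_iff O β a v w
  rw [e1, e2, Fintype.card_fin] at h
  exact h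

/-! #### transport to the address of a cut: reflect the prefix `[0, t)` -/

/-- **reflection law.** complementing the prefix `[0, t)`: `wt(u') + 2·W_t(u) = wt(u) + t`. -/
theorem wt_reflect (u : Fin n → Bool) (t : Fin n) :
    wt (segCompl u 0 t.val) + 2 * wtPrefix u t.val = wt u + t.val := by
  have hb := walkExp_segCompl u (i := 0) (j := t.val) (le_of_lt t.isLt) 0
  have h1 : ∀ x : Fin n → Bool, walkExp x 0 = wt x := by
    intro x; unfold walkExp; rw [TransferWalk.wtPrefix_zero, add_zero]
  have h2 : wseg u 0 t.val = wtPrefix u t.val := by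
    unfold wseg wtPrefix
    congr 1
    refine filter_congr fun x _ => ?_
    simp only [Nat.zero_le, true_and]
  rw [h1, h1, Nat.zero_min, wseg_eq_zero_of_le u (le_refl 0), h2] at hb
  omega

/-- **the address of cut `t` is the charge plus the weight of the reflected input, mod 3.** -/
theorem addr_eq_reflect (c : ℕ) (u : Fin n → Bool) (t : Fin n) :
    addr c u t.val = (c + wt (segCompl u 0 t.val)) % 3 := by
  have h := wt_reflect u t
  rw [addr_eq]
  unfold walkExp
  omega

/-- the reflected coefficient vector. -/
def reflA (a : Fin n → ZMod p) (t : Fin n) : Fin n → ZMod p := fun i => if i.val < t.val then -a i else a i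

/-- the reflected pattern. -/
def reflB (β : Fin n → Bool) (t : Fin n) : Fin n → Bool := fun j => if j.val < t.val then !β j else β j

/-- the form of the reflected input. -/
theorem form_reflect (a : Fin n → ZMod p) (u : Fin n → Bool) (t : Fin n) :
    form a (segCompl u 0 t.val) = form (reflA a t) u + ∑ i : Fin n, if i.val < t.val then a i else 0 := by
  unfold form reflA
  rw [← sum_add_distrib]
  refine sum_congr rfl fun i _ => ?_
  simp only [segCompl_apply, Nat.zero_le, true_and]
  by_cases hi : i.val < t.val <;> rcases Bool.eq_false_or_eq_true (u i) with hu | hu <;> simp [hi, hu]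

/-- the pattern of the reflected input. -/
theorem reflect_apply_eq_iff (u : Fin n → Bool) (t : Fin n) (β : Fin n → Bool) (j : Fin n) :
    segCompl u 0 t.val j = β j ↔ u j = reflB β t j := by
  unfold reflB
  simp only [segCompl_apply, Nat.zero_le, true_and]
  by_cases hj : j.val < t.val <;> rcases Bool.eq_false_or_eq_true (u j) with hu | hu <;>
    rcases Bool.eq_false_or_eq_true (β j) with hb | hb <;> simp [hj, hu, hb]

/-- counting through the reflection (an involution of the cube). -/
theorem card_filter_reflect (t : Fin n) (P : (Fin n → Bool) → Prop) [DecidablePred P] :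
    (univ.filter P).card = (univ.filter fun w => P (segCompl w 0 t.val)).card := by
  refine card_bij (fun u _ => segCompl u 0 t.val) ?_ ?_ ?_
  · intro u hu
    rw [mem_filter] at hu ⊢
    exact ⟨mem_univ _, by rw [segCompl_segCompl]; exact hu.2⟩
  · intro u₁ _ u₂ _ h
    rw [← segCompl_segCompl u₁ 0 t.val, h, segCompl_segCompl]
  · intro w hw
    refine ⟨segCompl w 0 t.val, ?_, segCompl_segCompl w 0 t.val⟩
    rw [mem_filter] at hw ⊢
    exact ⟨mem_univ _, hw.2⟩

/-- a cell is reflected onto a cell. -/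
theorem cell_reflect (O : Finset (Fin n)) (β : Fin n → Bool) (a : Fin n → ZMod p) (v : ZMod p) (t : Fin n) :
    (cell O β a v).card =
      (cell O (reflB β t) (reflA a t) (v - ∑ i : Fin n, if i.val < t.val then a i else 0)).card := by
  unfold cell
  rw [card_filter_reflect t]
  congr 1
  refine filter_congr fun w _ => ?_
  rw [form_reflect, eq_sub_iff_add_eq]
  simp only [reflect_apply_eq_iff]

/-- an address class of a cell is reflected onto a weight class of a cell. -/
theorem cell_addr_reflect (c : ℕ) (O : Finset (Fin n)) (β : Fin n → Bool) (a : Fin n → ZMod p) (v : ZMod p)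
    (t : Fin n) (rr : ℕ) (hrr : rr < 3) :
    ((cell O β a v).filter fun u => addr c u t.val = rr).card =
      ((cell O (reflB β t) (reflA a t) (v - ∑ i : Fin n, if i.val < t.val then a i else 0)).filter
        fun w => ((wt w : ℕ) : ZMod 3) = (rr : ZMod 3) - (c : ZMod 3)).card := by
  unfold cell
  rw [filter_filter, filter_filter, card_filter_reflect t]
  congr 1
  refine filter_congr fun w _ => ?_
  rw [form_reflect, eq_sub_iff_add_eq, addr_eq_reflect, segCompl_segCompl, eq_sub_iff_add_eq]
  simp only [reflect_apply_eq_iff]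
  have hmod : (c + wt w) % 3 = rr ↔ ((wt w : ℕ) : ZMod 3) + (c : ZMod 3) = (rr : ZMod 3) := by
    rw [← Nat.cast_add, add_comm (wt w) c, ZMod.natCast_eq_natCast_iff', Nat.mod_eq_of_lt hrr]
  rw [hmod]

/-- **COROLLARY (one-sided, u-side).** every address class of cut `t` on a cell holds at least a third of the cell, up to
`2(2cos(π/(3p)))ⁿ`. -/
theorem cell_le_three_addr (hp3 : p ≠ 3) (c : ℕ) (O : Finset (Fin n)) (β : Fin n → Bool) (a : Fin n → ZMod p)
    (v : ZMod p) (t : Fin n) (rr : ℕ) (hrr : rr < 3) :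
    ((cell O β a v).card : ℝ) ≤ 3 * (((cell O β a v).filter fun u => addr c u t.val = rr).card : ℝ)
      + 2 * (2 * Real.cos (Real.pi / (3 * p))) ^ n := by
  rw [cell_reflect O β a v t, cell_addr_reflect c O β a v t rr hrr]
  have h := third_on_cells hp3 O (reflB β t) (reflA a t) (v - ∑ i : Fin n, if i.val < t.val then a i else 0)
    ((rr : ZMod 3) - (c : ZMod 3))
  have := (abs_le.mp h).1
  linarith

end Cells


end Summit.QuantumAdvantage.AdviceFreeQNC0.JLinPeel.TokenDial
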